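import Summits.KontsevichZagierPeriods.KontsevichZagierPeriods.Theorems.MultiplicationThree.Negative.Pinned
import Literature.NumberTheory.Transcendental.KZSubcalculusInvariants

/-!
# `MultiplicationThree` (stmt-KontsevichZagierPeriods-3598) — negative knowledge, part 3: additivity alone never suffices

`not_mem_closure_additivity` / `not_multiplicationThreeByAdditivity`: for every rational `s > 0` and
ALL representations satisfying the pinning hypotheses, `[r] − [r']` is NOT in the subgroup generated
by the additivity moves (1a)+(1b). Invariant: the tree's `KZ.restrictedEval` over the window
`W = (1,2) × (1/4,1/2)` (inside the triangle, outside the unit box), which kills additivity and is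
`−∫_W (σ₁σ₂(3−σ₁−σ₂))^{s−1} < 0` on the pair. So every derivation of the crux uses a change of
variables or a Newton–Leibniz move. (cdisprove gen 1.)
-/

noncomputable section

open MeasureTheory Set Real
open scoped BigOperators

namespace Summit.KontsevichZagierPeriods.TerasomaMultiplication.MultiplicationThreeNegative

open Literature.NumberTheory.Transcendental
open Literature.NumberTheory.Transcendental.KZ
open Literature.ModelTheory.ExponentialFields (IsSemialgebraic)
open MvPolynomial (aeval X C)
open Summit.KontsevichZagierPeriods.KontsevichZagierPeriods.Theses.TerasomaMultiplication
  (MultiplicationThree)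

/-! ## §4 Refuted strengthening: additivity moves alone never suffice

The pair `[r] − [r']` has coefficient sum `0`, so the augmentation `KZ.coeffSum` (which kills the
subgroup of moves (2)+(3)) says nothing. But the restricted evaluation `KZ.restrictedEval` over the
window `W = (1,2) × (1/4,1/2)` — inside the triangle, outside the unit box — kills every additivity
move and does NOT vanish on the pair: so **every derivation of the crux uses a change of variables
or a Newton–Leibniz move** (the two domains are not even rearrangements of each other in situ). -/

/-- Lower corners of the separating windows (dimension-uniform family, only `n = 2` matters). [folklore] -/
def winLo (n : ℕ) (i : Fin n) : ℝ := if (i : ℕ) = 0 then 1 else 1/4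

/-- Upper corners of the separating windows. [folklore] -/
def winHi (n : ℕ) (i : Fin n) : ℝ := if (i : ℕ) = 0 then 2 else 1/2

/-- The separating windows: in dimension 2, `W = (1,2) × (1/4,1/2)`. [folklore] -/
def window (n : ℕ) : Set (Fin n → ℝ) := Set.pi Set.univ fun i => Ioo (winLo n i) (winHi n i)

/-- The windows are measurable. [folklore] -/
theorem measurableSet_window (n : ℕ) : MeasurableSet (window n) :=
  MeasurableSet.univ_pi fun _ => measurableSet_Ioo

/-- Membership in the dimension-2 window. [folklore] -/
theorem mem_window_two {x : Fin 2 → ℝ} :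
    x ∈ window 2 ↔ (1 < x 0 ∧ x 0 < 2) ∧ (1/4 < x 1 ∧ x 1 < 1/2) := by
  simp only [window, winLo, winHi, mem_pi, mem_univ, true_implies, Fin.forall_fin_two,
    Fin.val_zero, Fin.val_one, if_true, mem_Ioo]
  norm_num

/-- The window misses the unit box. [folklore] -/
theorem box_inter_window : box ∩ window 2 = ∅ := by
  ext x
  simp only [mem_inter_iff, mem_window_two, mem_empty_iff_false, iff_false, not_and]
  intro hx hw
  have := (hx 0).2
  linarith [hw.1]

/-- The window lies inside the triangle. [folklore] -/
theorem window_subset_triangle : window 2 ⊆ triangle := by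
  intro x hx
  rw [mem_window_two] at hx
  obtain ⟨⟨h0, h0'⟩, h1, h1'⟩ := hx
  exact ⟨by linarith, by linarith, by linarith⟩

/-- The window has positive volume (`1 · 1/4`). [folklore] -/
theorem volume_window_pos : 0 < volume (window 2) := by
  rw [window, Real.volume_pi_Ioo, Fin.prod_univ_two]
  simp only [winLo, winHi, Fin.val_zero, Fin.val_one, if_true]
  norm_num

/-- The simplex integrand is positive on the window. [folklore] -/
theorem simplexFun_pos_of_mem_window (s : ℚ) {x : Fin 2 → ℝ} (hx : x ∈ window 2) :
    0 < simplexFun s x := by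
  rw [mem_window_two] at hx
  obtain ⟨⟨h0, h0'⟩, h1, h1'⟩ := hx
  exact Real.rpow_pos_of_pos (mul_pos (mul_pos (by linarith) (by linarith)) (by linarith)) _

/-- The simplex integrand has positive integral over the window. [folklore] -/
theorem integral_window_simplexFun_pos {s : ℚ} (hs : 0 < s) :
    0 < ∫ x in window 2, simplexFun s x := by
  have hint : IntegrableOn (simplexFun s) (window 2) :=
    (integrableOn_simplexFun hs).mono_set window_subset_triangle
  rw [setIntegral_pos_iff_support_of_nonneg_ae ?_ hint]
  · refine volume_window_pos.trans_le (measure_mono fun x hx => ⟨?_, hx⟩)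
    exact (simplexFun_pos_of_mem_window s hx).ne'
  · exact ae_restrict_of_forall_mem (measurableSet_window 2) fun x hx =>
      (simplexFun_pos_of_mem_window s hx).le

/-- **Restricted evaluation of the pair** over the window family: `−∫_W (σ₁σ₂(3−σ₁−σ₂))^{s−1}`. [folklore] -/
theorem restrictedEval_window_pair {s : ℚ} (r r' : IntegralRep 2) (hr : r.domain = box)
    (hr' : r'.domain = triangle) (hri' : EqOn r'.integrand (simplexFun s) r'.domain) :
    restrictedEval window (of r - of r') = -∫ x in window 2, simplexFun s x := by
  simp only [map_sub, restrictedEval_of]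
  rw [hr, box_inter_window, setIntegral_empty, zero_sub, hr',
    inter_eq_right.mpr window_subset_triangle]
  congr 1
  refine setIntegral_congr_fun (measurableSet_window 2) fun x hx => hri' ?_
  rw [hr']
  exact window_subset_triangle hx

/-- **Additivity alone never suffices** (refuted strengthening `MultiplicationThreeByAdditivity`):
for every rational `s > 0` and ALL representations satisfying the pinning hypotheses of the crux,
`[r] − [r']` is NOT in the subgroup generated by the additivity moves (1a)+(1b). Witness: the
restricted evaluation over `W = (1,2) × (1/4,1/2)` (`KZ.closure_add_le_ker_restrictedEval`).
Hence any proof of the crux uses rule (2) or rule (3). [cite: KontsevichZagier2001, §1.2] -/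
theorem not_mem_closure_additivity {s : ℚ} (hs : 0 < s) (r r' : IntegralRep 2)
    (hr : r.domain = box) (hr' : r'.domain = triangle)
    (hri' : EqOn r'.integrand (simplexFun s) r'.domain) :
    of r - of r' ∉ AddSubgroup.closure (domainAddRel ∪ integrandAddRel) := by
  intro h
  have hk := closure_add_le_ker_restrictedEval window measurableSet_window h
  rw [AddMonoidHom.mem_ker, restrictedEval_window_pair r r' hr hr' hri'] at hk
  linarith [integral_window_simplexFun_pos hs]

/-- The strengthening "the pair is a pure dissection/re-summation identity". -/
def MultiplicationThreeByAdditivity : Prop :=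
  ∀ s : ℚ, 0 < s → ∀ (r r' : IntegralRep 2), r.domain = box →
    EqOn r.integrand (boxFun s) r.domain → r'.domain = triangle →
    EqOn r'.integrand (simplexFun s) r'.domain →
    of r - of r' ∈ AddSubgroup.closure (domainAddRel ∪ integrandAddRel)

/-- `MultiplicationThreeByAdditivity` is false (instance `s = 1`, pinned representations). [folklore] -/
theorem not_multiplicationThreeByAdditivity : ¬ MultiplicationThreeByAdditivity := fun h =>
  not_mem_closure_additivity one_pos (boxRep 1 one_pos) (simplexRep 1 one_pos) rfl rfl
    (fun _ _ => rfl) (h 1 one_pos _ _ rfl (fun _ _ => rfl) rfl (fun _ _ => rfl))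

end Summit.KontsevichZagierPeriods.TerasomaMultiplication.MultiplicationThreeNegative
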